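import Literature.AlgebraicGeometry.HodgeTheory.FermatLevelMap
import Literature.AlgebraicGeometry.Motives.VarietiesProperProofs
import Literature.AlgebraicGeometry.Motives.VarietiesProjectiveSpaceProofs
import Mathlib.AlgebraicGeometry.Morphisms.Finite
import Mathlib.AlgebraicGeometry.Morphisms.Proper
import Mathlib.AlgebraicGeometry.Morphisms.QuasiFinite
import HarnessLib

/-!
# The power map of `ℙⁿ⁺¹_ℂ` and the level map `π : Xⁿ_{km} ⟶ Xⁿₘ` of the Fermat hypersurfaces are finite morphisms

Family `hodge`, layer `Literature/AlgebraicGeometry/HodgeTheory`. PROOF FILE (theorems only: no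
definition, no named fact). Sequel of `HodgeTheory/ProjPowerMap` (the power map
`[x] ↦ [xᵏ]` of `Proj R[xᵢ : i ∈ ι]`, glued over the standard charts) and `HodgeTheory/FermatLevelMap`
(its restriction `fermatLevelMap n hk hm : Xⁿ_{km} ⟶ Xⁿₘ` to the standard models of the Fermat
hypersurfaces, Shioda–Katsura, Tôhoku Math. J. 31 (1979) §1: the quotient map
`Xⁿ_{km} → Xⁿ_{km}/(μₖ)ⁿ⁺² ≅ Xⁿₘ`). PROVED here:

* `ProjPowerMap.isAffineHom_powerMap` — **the power map is an affine morphism**: it pulls the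
  standard affine chart `D₊(xᵢ)` back to `D₊(xᵢᵏ) = D₊(xᵢ)`, which is affine
  (`ProjPowerMap.powerMap_preimage_basicOpen`, Mathlib `Proj.isAffineOpen_basicOpen`), and the
  `D₊(xᵢ)` cover `Proj R[x]`;
* `isProper_projPowerMap_left`, `isFinite_projPowerMap_left` — over `ℂ` the power map
  `P : ℙⁿ⁺¹_ℂ ⟶ ℙⁿ⁺¹_ℂ` is proper (a morphism between proper `ℂ`-schemes) hence, being affine,
  **finite** (Mathlib `IsFinite.iff_isProper_and_isAffineHom`);
* `isFinite_fermatLevelMap_left` — **the level map `π : Xⁿ_{km} ⟶ Xⁿₘ` is finite** for all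
  `n` and `k, m ≥ 1`: `π ≫ ι_m = ι_{km} ≫ P` (`fermatLevelMap_left_comp_ι`) is finite (closed
  immersions are finite) and `ι_m` is separated (Mathlib `IsFinite.of_comp`). In particular `π` is
  quasi-finite: its fibres on scheme points are discrete (Mathlib
  `Scheme.Hom.isDiscrete_preimage_singleton`), which is what the pull-back of supported classes
  along `π` consumes (`HodgeTheory/SupportedClassesQuasiFinitePullback`).

Not treated here: flatness of `π` (miracle flatness) and its degree `kⁿ⁺¹`.

## References

* [Hartshorne1977] R. Hartshorne, *Algebraic Geometry*, GTM 52 (1977), II Ex. 2.14 (the morphism of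
  `Proj` attached to a graded substitution, chart by chart), II Ex. 4.1 and Ex. 4.6 (finite =
  proper and affine), II Cor. 4.8 (e).
* [ShiodaKatsura1979] T. Shioda, T. Katsura, *On Fermat varieties*, Tôhoku Math. J. 31 (1979), §1.
-/

noncomputable section

open CategoryTheory AlgebraicGeometry MvPolynomial

namespace Literature.AlgebraicGeometry.HodgeTheory

/-! ### The power map is affine -/

namespace ProjPowerMap

open Literature.AlgebraicGeometry.Motives.Segre

variable (ι : Type) (R : Type) [CommRing R] {k : ℕ} (hk : 0 < k)

/-- **The power map `[x] ↦ [xᵏ]` of `Proj R[xᵢ : i ∈ ι]` is an affine morphism**: every point lies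
in some standard chart `D₊(xᵢ)` (the variables generate the irrelevant ideal), `D₊(xᵢ)` is affine,
and its preimage `D₊(φ xᵢ) = D₊(xᵢᵏ)` (`powerMap_preimage_basicOpen`) is affine as well. (The
grading `MvPolynomial.gradedAlgebra` is installed inside the proof with `letI`, as in the type of
`powerMap`.) [cite: Hartshorne1977, II Ex. 2.14] -/
theorem isAffineHom_powerMap : IsAffineHom (powerMap ι R hk) := by
  letI := MvPolynomial.gradedAlgebra (σ := ι) (R := R)
  refine isAffineHom_of_forall_exists_isAffineOpen _ fun x ↦ ?_
  have hx : x ∈ (⊤ : (Proj (homogeneousSubmodule ι R)).Opens) := trivial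
  rw [← Proj.iSup_basicOpen_eq_top (homogeneousSubmodule ι R) (fun i : ι ↦ (X i : MvPolynomial ι R))
    (irrelevant_le_span_X ι R), TopologicalSpace.Opens.mem_iSup] at hx
  obtain ⟨i, hi⟩ := hx
  refine ⟨Proj.basicOpen (homogeneousSubmodule ι R) (X i), hi,
    Proj.isAffineOpen_basicOpen (homogeneousSubmodule ι R) (X i) (X_mem R i) zero_lt_one, ?_⟩
  rw [powerMap_preimage_basicOpen ι R hk zero_lt_one (X_mem R i), expand_X]
  exact Proj.isAffineOpen_basicOpen (homogeneousSubmodule ι R) _ (pow_X_mem R k i) hk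

end ProjPowerMap

/-! ### Over `ℂ`: the power map and the level map are finite -/

section Complex

open Literature.AlgebraicGeometry.Motives

variable {n m k : ℕ}

/-- **The power map `P : ℙⁿ⁺¹_ℂ ⟶ ℙⁿ⁺¹_ℂ` is proper**: `ℙⁿ⁺¹_ℂ → Spec ℂ` is proper
(`Motives.IsSmoothProjective.isProper_holds` for `Motives.isSmoothProjective_projectiveSpace_holds`)
and separated, and `P` is a morphism over `Spec ℂ` (two-out-of-three for properness).
[cite: Hartshorne1977, II Cor. 4.8 (e)] -/
theorem isProper_projPowerMap_left (hk : 0 < k) : IsProper (projPowerMap n hk).left := by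
  haveI : IsProper (projectiveSpace (n + 1) ℂ).hom :=
    IsSmoothProjective.isProper_holds (isSmoothProjective_projectiveSpace_holds ℂ (n + 1))
  have h : IsProper ((projPowerMap n hk).left ≫ (projectiveSpace (n + 1) ℂ).hom) := by
    rw [Over.w]; infer_instance
  exact MorphismProperty.of_postcomp (W := @IsProper) (W' := @IsSeparated) _
    (projectiveSpace (n + 1) ℂ).hom inferInstance h

/-- **The power map `P : ℙⁿ⁺¹_ℂ ⟶ ℙⁿ⁺¹_ℂ`, `[x] ↦ [xᵏ]` (`k ≥ 1`), is a finite morphism**: proper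
(`isProper_projPowerMap_left`) and affine (`ProjPowerMap.isAffineHom_powerMap`), and a morphism is
finite iff it is proper and affine (Mathlib `IsFinite.iff_isProper_and_isAffineHom`). On the chart
`D₊(xᵢ)` it is `Spec` of `ℂ[x_j/x_i] → ℂ[x_j/x_i]`, `t ↦ tᵏ`, free of rank `kⁿ⁺¹`.
[cite: Hartshorne1977, II Ex. 4.6] -/
theorem isFinite_projPowerMap_left (hk : 0 < k) : IsFinite (projPowerMap n hk).left :=
  IsFinite.iff_isProper_and_isAffineHom.mpr
    ⟨isProper_projPowerMap_left hk, ProjPowerMap.isAffineHom_powerMap _ _ hk⟩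

/-- **The level map `π : Xⁿ_{km} ⟶ Xⁿₘ`, `[xᵢ] ↦ [xᵢᵏ]`, of the Fermat hypersurfaces is a finite
morphism** (`k, m ≥ 1`, every `n`): `π ≫ ι_m = ι_{km} ≫ P` (`fermatLevelMap_left_comp_ι`) with
`ι_{km}` a closed immersion (finite) and `P` finite (`isFinite_projPowerMap_left`), and `ι_m` is
separated, so `π` is finite (Mathlib `IsFinite.of_comp`). This is the quotient map by the finite
group `(μₖ)ⁿ⁺²` of Shioda–Katsura's inductive structure. [cite: ShiodaKatsura1979, §1] -/
theorem isFinite_fermatLevelMap_left (hk : 0 < k) (hm : 0 < m) :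
    IsFinite (fermatLevelMap n hk hm).left := by
  haveI := isFinite_projPowerMap_left (n := n) hk
  haveI : IsFinite ((fermatLevelMap n hk hm).left ≫
      (SmoothHypersurface.hypersurfaceι (fermatPolynomial ℂ n m)).left) := by
    rw [fermatLevelMap_left_comp_ι]; infer_instance
  exact IsFinite.of_comp _ (SmoothHypersurface.hypersurfaceι (fermatPolynomial ℂ n m)).left

/-- Hence the level map is **locally quasi-finite** (finite morphisms are quasi-finite): its fibres
on scheme points are discrete (Mathlib `Scheme.Hom.isDiscrete_preimage_singleton`).
[cite: Hartshorne1977, II Ex. 3.5 (a)] -/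
theorem locallyQuasiFinite_fermatLevelMap_left (hk : 0 < k) (hm : 0 < m) :
    LocallyQuasiFinite (fermatLevelMap n hk hm).left :=
  haveI := isFinite_fermatLevelMap_left (n := n) hk hm
  inferInstance

end Complex

end Literature.AlgebraicGeometry.HodgeTheory

end
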